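import Summits.QuantumFields.YangMills.Theorems.BalabanUVNodesN11NoExpansionUnitBranch
import Literature.MathematicalPhysics.QuantumFieldTheory.Balaban1983to89.Node00.CubeRoughSection
import Literature.MathematicalPhysics.QuantumFieldTheory.Balaban1983to89.B12ContinuousTransportInvariance
import Summits.QuantumFields.YangMills.Theorems.BalabanUVNodesN07Thm1ScaledInterfaceInstance

/-!
# DAG node N11 — THE FIRST (S1ᵀ)₁₃ INSTANCE FAILS AT EVERY STAGE-13 WITNESS WITH A PRINT-LIKE SMALL REGULARITY THRESHOLD: the event
# {U cube-rough ∧ Ū cube-rough} has POSITIVE Haar measure (it contains an open neighbourhood of the face section of the alternating coarse field), so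
# `TLaw₁₃ θ p 0` is FALSE whenever `θ.ν.εreg` lies in [B7] Prop. 2's range (`0 < K`, `M₂ ≥ 1`, grid condition, `SU(N)` non-trivial at the two thresholds)

Cell `pub-ymgap`, YM-PLAN Track A (HUMAN RULING D-0062), seat `pub-ymgap-dag-n11-d` (g5; R134 fan-out seat N11 [B14], strategy s2), item K1⁗ `StabilityBAtRecordR13Sep`
= stmt-QuantumFields-20290.  [III] = [Balaban1988Convergent], [I] = [Balaban1987RG1], [B7] = [Balaban1985Averaging].  Sequel of this seat's
`…NoExpansionUnitBranch` (p504384: under `TLaw₁₃ θ p 0` at a small-`εreg` witness, `dU{U ∈ R, Ū ∈ S} = 0` for the cube-rough fine fields `R` and the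
coarse fields `S` with a `2εreg`-rough cornered plaquette near every χ₁-cube) over this seat's Literature-side `Node00.CubeRoughSection` (half-guard of the
(0.4) small-loop average; the alternating coarse field; cube geometry) and ym3-torus' `B12ContinuousTransportInvariance` (`isOpenPosMeasure_fieldMeasure_SU`).

WHAT THIS FILE PROVES (0 `sorry`, 0 `def`, standard axioms).
* §1 `measurableSet_cubeRoughFine`, `isOpen_cubeRoughFine_lt`, `isOpen_cubeRoughCoarse_lt` — bookkeeping on the two events.
* §2 **`fieldMeasure_cubeRough_inter_preimage_pos`** — on the `K`-th torus of the family (`1 ≤ M₂`, so the χ₁-cubes have side `S = L²M₂R₁`, `L ∣ S`, `L ≤ S`),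
  for every `g : SU(N)` and thresholds `t₁, t₂ < dist1 g`:
  `0 < dU{U | every χ₁-cube `□′` has a plaquette `q ⊂ □′^∼` with `t₁ ≤ dist1 (U(∂q))`, and `Ū` has near every `□′` a cornered plaquette with `t₂ ≤ dist1`}`.
  The open set: the HALF-GUARD of the small-loop average ∩ the strict versions of the two conditions, the second pulled back by the CONTINUOUS averaging
  `avgFun expMeanLogSUc` (= the averaging of record on the half-guard); it contains the face section `faceSec V_g` of the alternating coarse field `V_g`
  (block-corner plaquettes of size `dist1 g` in every cube, `Ū = V_g` with all (0,1)-plaquettes of size `dist1 g`); `dU` charges open sets.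
* §3 **`not_slotsT_one_ae_zero_on_rough_of_small_εreg`** — Q-W answered at small `εreg`: def-T's all-large-field slot does NOT vanish a.e. on the rough coarse
  fields (source-agnostic `hvan` form); **`not_tLaw₁₃_zero_of_small_εreg`** — at EVERY Stage-13 `θ` with `θ.ν.εreg` in [B7] Prop. 2's range (`0 < εreg`, `C₀(d)εreg ≤ ⅓`, `2εreg ≤ 2δ_N∕((d+4)L)²`),
  ζ-unity, `1 ≤ M`, `1 ≤ M₁`, `1 ≤ M₂`, grid `3·L·M₁ ≤ sideχ`, `0 < ε₁η₁²`, the letters' junction `cR·ε₀ ≤ εreg·η₀²` and `cR·ε₀ ≤ εreg·η₁²`, 12a's measurability ∕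
  bound of the `Zt`-part displayed, and `SU(N)` non-trivial at the thresholds (`∃ g, ε₁η₁² + 8δ₀ < dist1 g ∧ 2εreg < dist1 g`; e.g. `N ≥ 2`): on every run with
  `0 < K`, **`¬ TLaw₁₃ F N θ p 0`**.  `…_of_hasResidualsOfRecord` — the same for a `θ` carrying K0b's residuals of record (ζ-unity and `Zt = ZtOfRecord` by name;
  no 12a hypothesis); `…_su2_…` — at the group of record `SU(2)` the non-triviality is n07-e's `su2_dist1_surj` (an element at distance `2`), leaving `ε₁η₁² + 8δ₀ < 2`.
  `not_s1T₁₃_su2_…` — hence the (S1ᵀ)₁₃ conjunct `∀ k < K, SLaw₁₃ θ p k → TLaw₁₃ θ p k` of K1⁗'s rung 1 is FALSE there (`SLaw₁₃ θ p 0` is def-T's theorem).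
  The all-large-field new sequence is built from def-T's own index map at the all-(3.2)-large label (`Ω₁ = ∅` by `StepWeightsAtNoExpansion`).

READING (count-neutral; nothing of Bałaban asserted or refuted).  In the TREE, the `k = 0` instance of K1⁗'s N11 conjunct (S1ᵀ)₁₃ — «the 𝐓-step of `ρ₀` at the
all-large-field new sequence is in §2 form» — is FALSE at every witness whose (2.12) regularity threshold is print-like small: def-R's solution map takes its
UNIT branch at rough data, the (3.2)∕(3.3) labels then charge the all-large-field sequence with the full Wilson mass of the cube-rough fine fields over cube-rough
averages (an open event), while 12a's `χreg_0(T)` cut kills the §2-form side there.  This is the kernel form of the desk's ME #15 verdict «typed-statement defect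
at the 12a∕def-T junction» — located at small `εreg`; the witness of record `theta13LiveOfRecord` has `εreg = 1`, OUTSIDE the range, where the branch of
`UminOfRecord` at rough data is not decided by the tree.  K1⁗ (an `∃ θ` statement) is NOT refuted; N11 ∕ K1⁗ NOT discharged; counts unmoved (typed 28∕28 ·
discharged 5∕28).  One finite four-torus at fixed `ε = L^{−K}`; NOT ℝ⁴ ∕ OS ∕ mass gap ∕ Clay.  Sources: [III] Theorem p.245, (2.10)–(2.13) pp.256–257,
(2.16)–(2.17) p.257, (3.1)–(3.5) pp.264–265, (3.25) p.270; [I] (0.3)–(0.4) pp.252–253; [B7] (9)–(10) p.19, Prop. 2 (52)–(54) p.26.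
-/

noncomputable section

open MeasureTheory ProbabilityTheory
open scoped BigOperators Matrix.Norms.L2Operator ENNReal NNReal

namespace Summit.QuantumFields.YangMills.Theorems.BalabanUVNodesN11SmallRegFirstStepFails

open Literature.MathematicalPhysics.QuantumFieldTheory.Balaban1983to89 T4Continuum Node00 Node00.Tk DagBinding
open Literature.MathematicalPhysics.QuantumFieldTheory.Balaban1983to89.ExpMeanLog (deltaSU)
open B15DeterminingSets (pts)
open B14.Eq213MaximalDomains (side)
open B14.Eq218Concrete (Seq)
open BlockAveraging (avgFun loopHol)
open ExpMeanLog (expMeanLogSU expMeanLogSUc)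
open BlockAveragingSection (faceSec)
open BlockAveragingSectionPlaq (offset)
open B15Eq112TorusCover (cover)
open B12ContinuousTransportInvarianceOn (continuous_dist1_SU continuous_plaqHol_SU)
open B12ContinuousTransportInvariance (isOpenPosMeasure_fieldMeasure_SU)
open GaugeField (plaqHol)
open Summit.QuantumFields.YangMills.Theorems.BalabanUVNodesN11AllLargeFieldLabel (sideD_pos sideχ_pos RkOfRecord_pos)
open Summit.QuantumFields.YangMills.BalabanUVNodes.N07Thm1ScaledInterfaceInstance (su2_dist1_surj)
open Summit.QuantumFields.YangMills.Theorems.BalabanUVNodesN11NoExpansionUnitBranch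
  (fieldMeasure_cubeRough_inter_preimage_eq_zero_of_slotsT_ae_zero fieldMeasure_cubeRough_inter_preimage_eq_zero_of_tLaw₁₃
    fieldMeasure_cubeRough_inter_preimage_eq_zero_of_tLaw₁₃_of_Zt_eq_ZtOfRecord)

variable {F : T4Family} {N : ℕ} [NeZero N]

/-! ## §1. The two events: measurability and open strict versions -/

section Events

variable (ν : Stage7Numerics) (p : B12.RunParams) (g : ℕ → ℝ)

/-- The set of CUBE-ROUGH fine fields (a plaquette with `dist1 ≥ t` inside every `□′^∼`) is measurable. [cite: Balaban1985Averaging, (9) p.19 (bookkeeping)] -/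
theorem measurableSet_cubeRoughFine (t : ℝ) :
    MeasurableSet {U : GaugeField (F.P p.K) 0 (SU N) | ∀ c : Iχ F ν p g 0,
      ∃ q ∈ plaqInside (cubeEnl (F.P p.K) (sideχ F ν p g 0) c 1), t ≤ dist1 (plaqHol U q)} := by
  have h : {U : GaugeField (F.P p.K) 0 (SU N) | ∀ c : Iχ F ν p g 0,
      ∃ q ∈ plaqInside (cubeEnl (F.P p.K) (sideχ F ν p g 0) c 1), t ≤ dist1 (plaqHol U q)} =
      ⋂ c : Iχ F ν p g 0, ⋃ q ∈ plaqInside (cubeEnl (F.P p.K) (sideχ F ν p g 0) c 1),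
        {U : GaugeField (F.P p.K) 0 (SU N) | t ≤ dist1 (plaqHol U q)} := by
    ext U; simp only [Set.mem_setOf_eq, Set.mem_iInter, Set.mem_iUnion, exists_prop]
  rw [h]
  refine MeasurableSet.iInter fun c => MeasurableSet.biUnion (Set.toFinite _).countable fun q _ => ?_
  exact measurableSet_le measurable_const (RegularGaugeGroup.measurable_dist1.comp (Missing.measurable_plaqHol q))

/-- The STRICT cube-rough condition on fine fields defines an open set. [cite: Balaban1985Averaging, (9) p.19 (bookkeeping)] -/
theorem isOpen_cubeRoughFine_lt (t : ℝ) :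
    IsOpen {U : GaugeField (F.P p.K) 0 (SU N) | ∀ c : Iχ F ν p g 0,
      ∃ q ∈ plaqInside (cubeEnl (F.P p.K) (sideχ F ν p g 0) c 1), t < dist1 (plaqHol U q)} := by
  have h : {U : GaugeField (F.P p.K) 0 (SU N) | ∀ c : Iχ F ν p g 0,
      ∃ q ∈ plaqInside (cubeEnl (F.P p.K) (sideχ F ν p g 0) c 1), t < dist1 (plaqHol U q)} =
      ⋂ c : Iχ F ν p g 0, ⋃ q ∈ plaqInside (cubeEnl (F.P p.K) (sideχ F ν p g 0) c 1),
        {U : GaugeField (F.P p.K) 0 (SU N) | t < dist1 (plaqHol U q)} := by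
    ext U; simp only [Set.mem_setOf_eq, Set.mem_iInter, Set.mem_iUnion, exists_prop]
  rw [h]
  refine isOpen_iInter_of_finite fun c => isOpen_biUnion fun q _ => ?_
  exact isOpen_lt continuous_const (continuous_dist1_SU.comp (continuous_plaqHol_SU q))

/-- The STRICT cornered-rough condition on coarse fields defines an open set. [cite: Balaban1985Averaging, (9) p.19 (bookkeeping)] -/
theorem isOpen_cubeRoughCoarse_lt (t : ℝ) :
    IsOpen {V1 : GaugeField (F.P p.K) 1 (SU N) | ∀ c : Iχ F ν p g 0, ∃ q : Plaq (F.P p.K) 1,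
      q.src ∈ pts 1 (cubeEnl (F.P p.K) (sideχ F ν p g 0) c 3) ∧ q.src.shift q.μ ∈ pts 1 (cubeEnl (F.P p.K) (sideχ F ν p g 0) c 3) ∧
        q.src.shift q.ν ∈ pts 1 (cubeEnl (F.P p.K) (sideχ F ν p g 0) c 3) ∧ t < dist1 (plaqHol V1 q)} := by
  have h : {V1 : GaugeField (F.P p.K) 1 (SU N) | ∀ c : Iχ F ν p g 0, ∃ q : Plaq (F.P p.K) 1,
      q.src ∈ pts 1 (cubeEnl (F.P p.K) (sideχ F ν p g 0) c 3) ∧ q.src.shift q.μ ∈ pts 1 (cubeEnl (F.P p.K) (sideχ F ν p g 0) c 3) ∧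
        q.src.shift q.ν ∈ pts 1 (cubeEnl (F.P p.K) (sideχ F ν p g 0) c 3) ∧ t < dist1 (plaqHol V1 q)} =
      ⋂ c : Iχ F ν p g 0, ⋃ q ∈ {q : Plaq (F.P p.K) 1 | q.src ∈ pts 1 (cubeEnl (F.P p.K) (sideχ F ν p g 0) c 3) ∧
          q.src.shift q.μ ∈ pts 1 (cubeEnl (F.P p.K) (sideχ F ν p g 0) c 3) ∧ q.src.shift q.ν ∈ pts 1 (cubeEnl (F.P p.K) (sideχ F ν p g 0) c 3)},
        {V1 : GaugeField (F.P p.K) 1 (SU N) | t < dist1 (plaqHol V1 q)} := by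
    ext V1
    simp only [Set.mem_setOf_eq, Set.mem_iInter, Set.mem_iUnion, exists_prop, and_assoc]
  rw [h]
  refine isOpen_iInter_of_finite fun c => isOpen_biUnion fun q _ => ?_
  exact isOpen_lt continuous_const (continuous_dist1_SU.comp (continuous_plaqHol_SU q))

end Events

/-! ## §2. Positivity: the cube-rough fine fields with cube-rough averages carry positive Haar measure -/

section Positivity

variable (F N)
variable (ν : Stage7Numerics) (p : B12.RunParams) (g : ℕ → ℝ)

/-- `L ∣ sideχ` and `L ≤ sideχ` at the first step when `M₂ ≥ 1` (`sideχ = L²·M₂·R₁`). [cite: Balaban1988Convergent, (2.17) p.257, (3.2) p.265 (bookkeeping)] -/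
theorem dvd_sideχ_zero_and_le (hM₂ : 1 ≤ ν.M₂) : (F.P p.K).L ∣ sideχ F ν p g 0 ∧ (F.P p.K).L ≤ sideχ F ν p g 0 := by
  have hL := (F.P p.K).L_pos
  have hR := RkOfRecord_pos hL ν.r (g (0 + 1))
  unfold sideχ cubeSide
  refine ⟨Dvd.dvd.mul_right (Dvd.dvd.mul_right (dvd_pow_self _ (by norm_num)) _) _, ?_⟩
  calc (F.P p.K).L = (F.P p.K).L * 1 * 1 := by ring
    _ ≤ (F.P p.K).L ^ (0 + 1 + 1) * ν.M₂ * RkOfRecord (F.P p.K).L ν.r (g (0 + 1)) := by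
        refine Nat.mul_le_mul (Nat.mul_le_mul ?_ hM₂) hR
        calc (F.P p.K).L = (F.P p.K).L ^ 1 := (pow_one _).symm
          _ ≤ (F.P p.K).L ^ (0 + 1 + 1) := Nat.pow_le_pow_right hL (by norm_num)

/-- **THE CUBE-ROUGH FINE FIELDS WITH CUBE-ROUGH AVERAGES HAVE POSITIVE HAAR MEASURE** (`1 ≤ M₂`; `g : SU(N)` with `t₁, t₂ < dist1 g`): the event
{every χ₁-cube `□′` has a plaquette `q ⊂ □′^∼` with `t₁ ≤ dist1 (U(∂q))`} ∩ {the averaging of record `Ū` has, near every `□′`, a plaquette cornered in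
`pts 1 (□′^{∼3})` with `t₂ ≤ dist1`} contains an OPEN NEIGHBOURHOOD of the face section of the alternating coarse field — the half-guard of the small-loop
average (where the averaging of record is the continuous `avgFun expMeanLogSUc`) cut by the strict conditions — and `dU` charges open sets.
[cite: Balaban1987RG1, (0.3)–(0.4) pp.252–253; Balaban1985Averaging, (9)–(10) p.19; Balaban1988Convergent, (2.17) p.257, (3.2)–(3.3) p.265] -/
theorem fieldMeasure_cubeRough_inter_preimage_pos (hM₂ : 1 ≤ ν.M₂) (g₀ : SU N) {t₁ t₂ : ℝ} (ht₁ : t₁ < dist1 g₀) (ht₂ : t₂ < dist1 g₀) :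
    0 < fieldMeasure (F.P p.K) 0 (SU N)
      ({U : GaugeField (F.P p.K) 0 (SU N) | ∀ c : Iχ F ν p g 0,
          ∃ q ∈ plaqInside (cubeEnl (F.P p.K) (sideχ F ν p g 0) c 1), t₁ ≤ dist1 (plaqHol U q)} ∩
        (avOfRecord F N p.K 0).avg ⁻¹'
          {V1 : GaugeField (F.P p.K) 1 (SU N) | ∀ c : Iχ F ν p g 0, ∃ q : Plaq (F.P p.K) 1,
            q.src ∈ pts 1 (cubeEnl (F.P p.K) (sideχ F ν p g 0) c 3) ∧ q.src.shift q.μ ∈ pts 1 (cubeEnl (F.P p.K) (sideχ F ν p g 0) c 3) ∧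
              q.src.shift q.ν ∈ pts 1 (cubeEnl (F.P p.K) (sideχ F ν p g 0) c 3) ∧ t₂ ≤ dist1 (plaqHol V1 q)}) := by
  haveI := isOpenPosMeasure_fieldMeasure_SU (N := N) (F.P p.K) 0
  set S := sideχ F ν p g 0 with hS_def
  obtain ⟨hLS, hLS'⟩ := dvd_sideχ_zero_and_le F ν p g hM₂
  have hmK : 1 ≤ (F.P p.K).m + (F.P p.K).K := by have := F.hm; rw [T4Family.P_m]; omega
  have hmK' : 0 + 1 ≤ (F.P p.K).m + (F.P p.K).K := by omega
  have hd : 2 ≤ (F.P p.K).d := by rw [T4Family.P_d]; norm_num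
  have h01 : (⟨0, by omega⟩ : Fin (F.P p.K).d) < ⟨1, by omega⟩ := Fin.mk_lt_mk.2 Nat.zero_lt_one
  -- the open neighbourhood
  set O : Set (GaugeField (F.P p.K) 0 (SU N)) :=
    {U | ∀ (c : PBond (F.P p.K) (0 + 1)) (i : BlockAveraging.Idx (F.P p.K)), dist1 (loopHol U c i) < (expMeanLogSU (n := Fin N)).δ / 2} ∩
    ({U : GaugeField (F.P p.K) 0 (SU N) | ∀ c : Iχ F ν p g 0,
        ∃ q ∈ plaqInside (cubeEnl (F.P p.K) S c 1), t₁ < dist1 (plaqHol U q)} ∩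
      avgFun (expMeanLogSUc (n := Fin N)) ⁻¹'
        {V1 : GaugeField (F.P p.K) 1 (SU N) | ∀ c : Iχ F ν p g 0, ∃ q : Plaq (F.P p.K) 1,
          q.src ∈ pts 1 (cubeEnl (F.P p.K) S c 3) ∧ q.src.shift q.μ ∈ pts 1 (cubeEnl (F.P p.K) S c 3) ∧
            q.src.shift q.ν ∈ pts 1 (cubeEnl (F.P p.K) S c 3) ∧ t₂ < dist1 (plaqHol V1 q)}) with hO_def
  have hO : IsOpen O :=
    isOpen_halfSmall.inter ((isOpen_cubeRoughFine_lt ν p g t₁).inter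
      ((isOpen_cubeRoughCoarse_lt ν p g t₂).preimage BlockAveraging.continuous_avgFun_expMeanLogSUc))
  -- it lies inside the event: on the half-guard the averaging of record is the continuous one
  have hsub : O ⊆ {U : GaugeField (F.P p.K) 0 (SU N) | ∀ c : Iχ F ν p g 0,
          ∃ q ∈ plaqInside (cubeEnl (F.P p.K) S c 1), t₁ ≤ dist1 (plaqHol U q)} ∩
        (avOfRecord F N p.K 0).avg ⁻¹'
          {V1 : GaugeField (F.P p.K) 1 (SU N) | ∀ c : Iχ F ν p g 0, ∃ q : Plaq (F.P p.K) 1,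
            q.src ∈ pts 1 (cubeEnl (F.P p.K) S c 3) ∧ q.src.shift q.μ ∈ pts 1 (cubeEnl (F.P p.K) S c 3) ∧
              q.src.shift q.ν ∈ pts 1 (cubeEnl (F.P p.K) S c 3) ∧ t₂ ≤ dist1 (plaqHol V1 q)} := by
    rintro U ⟨hhalf, hfine, hcoarse⟩
    refine ⟨fun c => ?_, ?_⟩
    · obtain ⟨q, hq, hlt⟩ := hfine c
      exact ⟨q, hq, hlt.le⟩
    · rw [Set.mem_preimage, avOfRecord_avg_eq_SUc_of_halfSmall F p.K 0 U hhalf, Set.mem_setOf_eq]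
      intro c
      obtain ⟨q, h1, h2, h3, hlt⟩ := hcoarse c
      exact ⟨q, h1, h2, h3, hlt.le⟩
  -- and it contains the face section of the alternating coarse field
  obtain ⟨V₀, hV₀, hface⟩ := exists_coarse_faceSec_corner_dist1_eq (P := F.P p.K) (j := 0) (G := SU N) hd hmK' g₀
  have hmem : faceSec V₀ ∈ O := by
    refine ⟨halfSmall_faceSec hmK' V₀, fun c => ?_, ?_⟩
    · refine ⟨⟨cover (F.P p.K) (fun i => (S : ℤ) * (c : B14DomainGeom.Pt (F.P p.K).d) i + (((F.P p.K).L - 1 : ℕ) : ℤ)), _, _, h01⟩,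
        cornerPlaq_mem_plaqInside (F.P p.K) hLS' _ h01, ?_⟩
      rw [hface _ h01 (offset_cover_corner (F.P p.K) hLS hmK _ _) (offset_cover_corner (F.P p.K) hLS hmK _ _)]
      exact ht₁
    · rw [Set.mem_preimage, avgFun_expMeanLogSUc_faceSec hmK' V₀, Set.mem_setOf_eq]
      intro c
      obtain ⟨h1, h2, h3⟩ := emb_blockOf_corner_mem (F.P p.K) hLS hLS' hmK (c : B14DomainGeom.Pt (F.P p.K).d)
        (⟨0, by omega⟩ : Fin (F.P p.K).d) ⟨1, by omega⟩
      refine ⟨⟨blockOf (cover (F.P p.K) (fun i => (S : ℤ) * (c : B14DomainGeom.Pt (F.P p.K).d) i + (((F.P p.K).L - 1 : ℕ) : ℤ))),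
        _, _, h01⟩, h1, h2, h3, ?_⟩
      rw [hV₀ _ h01]
      exact ht₂
  exact (hO.measure_pos (fieldMeasure (F.P p.K) 0 (SU N)) ⟨_, hmem⟩).trans_le (measure_mono hsub)

end Positivity

/-! ## §3. `¬ TLaw₁₃ θ p 0` at every Stage-13 witness with `εreg` in [B7] Prop. 2's range -/

section Negative

variable (θ : Stage13Params F N) (p : B12.RunParams)

/-- THE ALL-LARGE-FIELD NEW SEQUENCE from def-T's own index map: the label `P₁ = all χ₁-cubes` appended to the empty sequence has `Ω₁ = ∅`
(`StepWeightsAtNoExpansion.OmegaOfLabel_zero_eq_empty_of_fst_eq_univ`; `0 <` the two cube sides). [cite: Balaban1988Convergent, (3.5) p.265] -/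
theorem exists_seq_one_Omega_empty (hD : 0 < sideD F θ.ν θ.τ9.M p (gOfRecord₁₃ F N θ p) 0) (hχ : 0 < sideχ F θ.ν p (gOfRecord₁₃ F N θ p) 0) :
    ∃ s : SeqOfRecord F θ.ν θ.τ9.M (gOfRecord₁₃ F N θ p) p.K 1, s.Ω 1 = ∅ := by
  classical
  refine ⟨σOfRecord F θ.ν θ.τ9.M p (gOfRecord₁₃ F N θ p) 0 (Seq.zero _) (Finset.univ, ∅, (∅, ∅)), ?_⟩
  rw [σOfRecord_Ω_succ]
  exact OmegaOfLabel_zero_eq_empty_of_fst_eq_univ F θ.ν θ.τ9.M p (gOfRecord₁₃ F N θ p) _ hD hχ _ rfl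

/-- **Q-W ANSWERED IN THE TREE AT SMALL `εreg`: def-T's ALL-LARGE-FIELD PRE-𝐑 SLOT DOES NOT VANISH a.e. ON THE ROUGH COARSE FIELDS** — for every new
sequence `s` with `Ω₁(s) = ∅` at a Stage-13 `θ` with `εreg` in [B7] Prop. 2's range (ζ-unity, `1 ≤ M, M₁, M₂`, grid, `0 < ε₁η₁²`, `0 < K`, `SU(N)` non-trivial at the
thresholds), it is FALSE that `slotT_1(s)(V₁) = 0` for a.e. `V₁` not `2εreg(Lη₁)²`-plaquette-small.  Source-agnostic: composes with this seat's `TLaw₁₃` route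
(`…RoughFibre`) and with seat dag-n11-e's `SLaw₁₃`-side route alike. [cite: Balaban1988Convergent, (3.1)–(3.5) pp.264–265, (3.25) p.270, (2.12) p.256; Balaban1985Averaging, (10) p.19, Prop. 2 (52)–(54) p.26; Balaban1987RG1, (0.4) p.253] -/
theorem not_slotsT_one_ae_zero_on_rough_of_small_εreg (hζ : IsZetaUnity F N θ.ν θ.τ9.M θ.ζ) (hK : 0 < p.K) (hMτ : 1 ≤ θ.τ9.M)
    (hε : 0 < θ.ν.εreg)
    (hε3 : (143 * (((((F.P p.K).d + 4 : ℕ) : ℝ)) ^ 2 / 4) ^ 2) * θ.ν.εreg ≤ 1 / 3)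
    (hε2 : 2 * θ.ν.εreg ≤ 2 * deltaSU (Fin N) / ((((F.P p.K).d + 4) * (F.P p.K).L : ℕ) : ℝ) ^ 2)
    (hM : 1 ≤ θ.ν.M₁) (hM₂ : 1 ≤ θ.ν.M₂) (h3 : 3 * side (F.P p.K).L θ.ν.M₁ 1 ≤ sideχ F θ.ν p (gOfRecord₁₃ F N θ p) 0)
    (hε₁ : 0 < epsOfRecord θ.ν (gOfRecord₁₃ F N θ p) 1 * (F.P p.K).eta 1 ^ 2)
    (hg : ∃ g₀ : SU N,
      epsOfRecord θ.ν (gOfRecord₁₃ F N θ p) 1 * (F.P p.K).eta 1 ^ 2 + 4 * (2 * deltaOfRecord θ.ν (gOfRecord₁₃ F N θ p) 0 θ.A₁) < dist1 g₀ ∧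
        2 * θ.ν.εreg < dist1 g₀)
    (s : SeqOfRecord F θ.ν θ.τ9.M (gOfRecord₁₃ F N θ p) p.K 1) (hΩ : s.Ω 1 = ∅) :
    ¬ (∀ᵐ V1 ∂fieldMeasure (F.P p.K) 1 (SU N), ¬ PlaqSmall (2 * θ.ν.εreg * (((F.P p.K).L : ℝ) ^ 1 * (F.P p.K).eta 1) ^ 2) V1 →
      slotsTOfRecord F N θ.ν θ.τ9 (EOfRecord₁₃ F N θ) (wOfRecord₉ F N θ.toStage9Params) θ.ppSel p (gOfRecord₁₃ F N θ p) 1 s V1 = 0) := by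
  intro hvan
  have hD := sideD_pos (F := F) θ.ν hMτ p (gOfRecord₁₃ F N θ p) 0
  have hχ := sideχ_pos (F := F) hM₂ p (gOfRecord₁₃ F N θ p) 0
  have hmK : 1 ≤ (F.P p.K).m + (F.P p.K).K := by have := F.hm; rw [T4Family.P_m]; omega
  obtain ⟨g₀, hg₁, hg₂⟩ := hg
  have h0 := fieldMeasure_cubeRough_inter_preimage_eq_zero_of_slotsT_ae_zero θ p hζ hD hχ hK hmK hε hε3 hε2 hM h3 hε₁ s hΩ hvan
    (measurableSet_cubeRoughFine θ.ν p (gOfRecord₁₃ F N θ p) _) (fun U hU => hU)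
  have hpos := fieldMeasure_cubeRough_inter_preimage_pos F N θ.ν p (gOfRecord₁₃ F N θ p) hM₂ g₀ hg₁ hg₂
  exact hpos.ne' h0

/-- **`¬ TLaw₁₃ θ p 0` AT EVERY STAGE-13 WITNESS WITH `εreg` IN [B7] PROP. 2's RANGE** (any `θ.ζ` with unity, any `θ.Zt` with 12a's measurability ∕ bound
displayed; `0 < K`; `1 ≤ M`, `1 ≤ M₁`, `1 ≤ M₂`; grid `3·L·M₁ ≤ sideχ`; `0 < ε₁η₁²`; junction `cR·ε₀ ≤ εreg·η₀²` and `cR·ε₀ ≤ εreg·η₁²`; `SU(N)` non-trivial at the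
thresholds).  Proof: `…UnitBranch` makes {U cube-rough, Ū cube-rough} `dU`-null under `TLaw₁₃ θ p 0`; §2 makes it `dU`-positive.
[cite: Balaban1988Convergent, Theorem p.245, (3.25) p.270, (2.10)–(2.12) p.256, (3.2)–(3.5) p.265; Balaban1985Averaging, (10) p.19, Prop. 2 (52)–(54) p.26; Balaban1987RG1, (0.4) p.253] -/
theorem not_tLaw₁₃_zero_of_small_εreg (hζ : IsZetaUnity F N θ.ν θ.τ9.M θ.ζ) (hK : 0 < p.K) (hMτ : 1 ≤ θ.τ9.M)
    (hε : 0 < θ.ν.εreg)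
    (hε3 : (143 * (((((F.P p.K).d + 4 : ℕ) : ℝ)) ^ 2 / 4) ^ 2) * θ.ν.εreg ≤ 1 / 3)
    (hε2 : 2 * θ.ν.εreg ≤ 2 * deltaSU (Fin N) / ((((F.P p.K).d + 4) * (F.P p.K).L : ℕ) : ℝ) ^ 2)
    (hM : 1 ≤ θ.ν.M₁) (hM₂ : 1 ≤ θ.ν.M₂) (h3 : 3 * side (F.P p.K).L θ.ν.M₁ 1 ≤ sideχ F θ.ν p (gOfRecord₁₃ F N θ p) 0)
    (hε₁ : 0 < epsOfRecord θ.ν (gOfRecord₁₃ F N θ p) 1 * (F.P p.K).eta 1 ^ 2)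
    (hc : θ.s2.cR * epsOfRecord θ.ν (gOfRecord₁₃ F N θ p) 0 ≤ θ.ν.εreg * (F.P p.K).eta 0 ^ 2)
    (hαε : θ.s2.cR * epsOfRecord θ.ν (gOfRecord₁₃ F N θ p) 0 ≤ θ.ν.εreg * (F.P p.K).eta 1 ^ 2)
    (hg : ∃ g₀ : SU N,
      epsOfRecord θ.ν (gOfRecord₁₃ F N θ p) 1 * (F.P p.K).eta 1 ^ 2 + 4 * (2 * deltaOfRecord θ.ν (gOfRecord₁₃ F N θ p) 0 θ.A₁) < dist1 g₀ ∧
        2 * θ.ν.εreg < dist1 g₀)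
    {C : ℝ}
    (hm : Measurable (Function.uncurry fun (V1 : GaugeField (F.P p.K) 1 (SU N)) (Uf : GaugeField (F.P p.K) 0 (SU N)) =>
      (θ.Zt p.K).ζ0 0 Set.univ (pairCfg V1 Uf) *
          chiRegW F N (FluctV N) θ.ν θ.s2.cR p (gOfRecord₁₃ F N θ p) 0 Set.univ (pairCfg (V := FluctV N) V1 Uf) *
        (Real.exp (-(1 / 2 : ℝ) * (θ.Zt p.K).quad 0 ∅ (pairCfg V1 Uf)) * rhoZeroOfRecord F N p.K p.g0 (EOfRecord₁₃ F N θ p) Uf)))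
    (hC : ∀ (V1 : GaugeField (F.P p.K) 1 (SU N)) (Uf : GaugeField (F.P p.K) 0 (SU N)),
      |(θ.Zt p.K).ζ0 0 Set.univ (pairCfg V1 Uf) *
          chiRegW F N (FluctV N) θ.ν θ.s2.cR p (gOfRecord₁₃ F N θ p) 0 Set.univ (pairCfg (V := FluctV N) V1 Uf) *
        (Real.exp (-(1 / 2 : ℝ) * (θ.Zt p.K).quad 0 ∅ (pairCfg V1 Uf)) * rhoZeroOfRecord F N p.K p.g0 (EOfRecord₁₃ F N θ p) Uf)| ≤ C) :
    ¬ TLaw₁₃ F N θ p 0 := by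
  intro hT
  have hD := sideD_pos (F := F) θ.ν hMτ p (gOfRecord₁₃ F N θ p) 0
  have hχ := sideχ_pos (F := F) hM₂ p (gOfRecord₁₃ F N θ p) 0
  have hmK : 1 ≤ (F.P p.K).m + (F.P p.K).K := by have := F.hm; rw [T4Family.P_m]; omega
  obtain ⟨s, hΩ⟩ := exists_seq_one_Omega_empty θ p hD hχ
  obtain ⟨g₀, hg₁, hg₂⟩ := hg
  have h0 := fieldMeasure_cubeRough_inter_preimage_eq_zero_of_tLaw₁₃ θ p hζ hD hχ hK hmK hε hε3 hε2 hM h3 hε₁ hc hMτ hαε s hΩ hT hm hC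
    (measurableSet_cubeRoughFine θ.ν p (gOfRecord₁₃ F N θ p) _) (fun U hU => hU)
  have hpos := fieldMeasure_cubeRough_inter_preimage_pos F N θ.ν p (gOfRecord₁₃ F N θ p) hM₂ g₀ hg₁ hg₂
  exact hpos.ne' h0

/-- **THE SAME FOR A WITNESS CARRYING K0b's RESIDUALS OF RECORD** (`θ.HasResidualsOfRecord`: ζ-unity and `Zt = ZtOfRecord` by name — no 12a hypothesis left).
[cite: Balaban1988Convergent, Theorem p.245, (3.25) p.270, (2.12) p.256, (3.2)–(3.5) p.265; Balaban1985Averaging, Prop. 2 (52)–(54) p.26; Balaban1987RG1, (0.4) p.253] -/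
theorem not_tLaw₁₃_zero_of_hasResidualsOfRecord_of_small_εreg (hres : θ.HasResidualsOfRecord F N) (hK : 0 < p.K) (hMτ : 1 ≤ θ.τ9.M)
    (hε : 0 < θ.ν.εreg)
    (hε3 : (143 * (((((F.P p.K).d + 4 : ℕ) : ℝ)) ^ 2 / 4) ^ 2) * θ.ν.εreg ≤ 1 / 3)
    (hε2 : 2 * θ.ν.εreg ≤ 2 * deltaSU (Fin N) / ((((F.P p.K).d + 4) * (F.P p.K).L : ℕ) : ℝ) ^ 2)
    (hM : 1 ≤ θ.ν.M₁) (hM₂ : 1 ≤ θ.ν.M₂) (h3 : 3 * side (F.P p.K).L θ.ν.M₁ 1 ≤ sideχ F θ.ν p (gOfRecord₁₃ F N θ p) 0)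
    (hε₁ : 0 < epsOfRecord θ.ν (gOfRecord₁₃ F N θ p) 1 * (F.P p.K).eta 1 ^ 2)
    (hc : θ.s2.cR * epsOfRecord θ.ν (gOfRecord₁₃ F N θ p) 0 ≤ θ.ν.εreg * (F.P p.K).eta 0 ^ 2)
    (hαε : θ.s2.cR * epsOfRecord θ.ν (gOfRecord₁₃ F N θ p) 0 ≤ θ.ν.εreg * (F.P p.K).eta 1 ^ 2)
    (hg : ∃ g₀ : SU N,
      epsOfRecord θ.ν (gOfRecord₁₃ F N θ p) 1 * (F.P p.K).eta 1 ^ 2 + 4 * (2 * deltaOfRecord θ.ν (gOfRecord₁₃ F N θ p) 0 θ.A₁) < dist1 g₀ ∧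
        2 * θ.ν.εreg < dist1 g₀) :
    ¬ TLaw₁₃ F N θ p 0 := by
  intro hT
  have hD := sideD_pos (F := F) θ.ν hMτ p (gOfRecord₁₃ F N θ p) 0
  have hχ := sideχ_pos (F := F) hM₂ p (gOfRecord₁₃ F N θ p) 0
  have hmK : 1 ≤ (F.P p.K).m + (F.P p.K).K := by have := F.hm; rw [T4Family.P_m]; omega
  obtain ⟨s, hΩ⟩ := exists_seq_one_Omega_empty θ p hD hχ
  obtain ⟨g₀, hg₁, hg₂⟩ := hg
  have h0 := fieldMeasure_cubeRough_inter_preimage_eq_zero_of_tLaw₁₃_of_Zt_eq_ZtOfRecord θ p hres.Zt_eq hres.zetaUnity hD hχ hK hmK hε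
    hε3 hε2 hM h3 hε₁ hc hMτ hαε s hΩ hT (measurableSet_cubeRoughFine θ.ν p (gOfRecord₁₃ F N θ p) _) (fun U hU => hU)
  have hpos := fieldMeasure_cubeRough_inter_preimage_pos F N θ.ν p (gOfRecord₁₃ F N θ p) hM₂ g₀ hg₁ hg₂
  exact hpos.ne' h0

/-- **AT THE GROUP OF RECORD `SU(2)`** the non-triviality hypothesis is discharged by an element at distance `2` from the identity (n07-e's `su2_dist1_surj`) as
soon as `ε₁η₁² + 8δ₀ < 2` (`2εreg < 2` is implied by the Prop-2 guard at `d = 4`): for a `θ : Stage13Params F 2` carrying K0b's residuals with `εreg` in range,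
**`¬ TLaw₁₃ F 2 θ p 0`** on every run with `0 < K`. [cite: Balaban1988Convergent, Theorem p.245, (3.25) p.270, (2.12) p.256; Balaban1985Averaging, Prop. 2 (52)–(54) p.26; Balaban1987RG1, (0.4) p.253] -/
theorem not_tLaw₁₃_zero_su2_of_hasResidualsOfRecord_of_small_εreg {F : T4Family} (θ : Stage13Params F 2) (p : B12.RunParams)
    (hres : θ.HasResidualsOfRecord F 2) (hK : 0 < p.K) (hMτ : 1 ≤ θ.τ9.M) (hε : 0 < θ.ν.εreg)
    (hε3 : (143 * (((((F.P p.K).d + 4 : ℕ) : ℝ)) ^ 2 / 4) ^ 2) * θ.ν.εreg ≤ 1 / 3)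
    (hε2 : 2 * θ.ν.εreg ≤ 2 * deltaSU (Fin 2) / ((((F.P p.K).d + 4) * (F.P p.K).L : ℕ) : ℝ) ^ 2)
    (hM : 1 ≤ θ.ν.M₁) (hM₂ : 1 ≤ θ.ν.M₂) (h3 : 3 * side (F.P p.K).L θ.ν.M₁ 1 ≤ sideχ F θ.ν p (gOfRecord₁₃ F 2 θ p) 0)
    (hε₁ : 0 < epsOfRecord θ.ν (gOfRecord₁₃ F 2 θ p) 1 * (F.P p.K).eta 1 ^ 2)
    (hc : θ.s2.cR * epsOfRecord θ.ν (gOfRecord₁₃ F 2 θ p) 0 ≤ θ.ν.εreg * (F.P p.K).eta 0 ^ 2)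
    (hαε : θ.s2.cR * epsOfRecord θ.ν (gOfRecord₁₃ F 2 θ p) 0 ≤ θ.ν.εreg * (F.P p.K).eta 1 ^ 2)
    (hδ : epsOfRecord θ.ν (gOfRecord₁₃ F 2 θ p) 1 * (F.P p.K).eta 1 ^ 2 + 4 * (2 * deltaOfRecord θ.ν (gOfRecord₁₃ F 2 θ p) 0 θ.A₁) < 2) :
    ¬ TLaw₁₃ F 2 θ p 0 := by
  obtain ⟨g₀, hg₀⟩ := su2_dist1_surj 2 zero_le_two le_rfl
  have hd : (F.P p.K).d = 4 := rfl
  have hεlt : 2 * θ.ν.εreg < 2 := by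
    rw [hd] at hε3
    norm_num at hε3
    linarith
  exact not_tLaw₁₃_zero_of_hasResidualsOfRecord_of_small_εreg θ p hres hK hMτ hε hε3 hε2 hM hM₂ h3 hε₁ hc hαε
    ⟨g₀, by rw [hg₀]; exact hδ, by rw [hg₀]; exact hεlt⟩

/-- **HENCE THE (S1ᵀ)₁₃ SLOT ITSELF FAILS THERE**: at such a `θ : Stage13Params F 2` (K0b's residuals, `εreg` in range, `0 < K`), the N11 conjunct
`∀ k < K, SLaw₁₃ θ p k → TLaw₁₃ θ p k` of K1⁗'s rung 1 is FALSE — `SLaw₁₃ θ p 0` is def-T's theorem `sLaw₁₃_zero`, and `TLaw₁₃ θ p 0` fails.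
[cite: Balaban1988Convergent, Theorem p.245, Thm 1 p.262, (3.25) p.270; Balaban1985Averaging, Prop. 2 (52)–(54) p.26] -/
theorem not_s1T₁₃_su2_of_hasResidualsOfRecord_of_small_εreg {F : T4Family} (θ : Stage13Params F 2) (p : B12.RunParams)
    (hres : θ.HasResidualsOfRecord F 2) (hK : 0 < p.K) (hMτ : 1 ≤ θ.τ9.M) (hε : 0 < θ.ν.εreg)
    (hε3 : (143 * (((((F.P p.K).d + 4 : ℕ) : ℝ)) ^ 2 / 4) ^ 2) * θ.ν.εreg ≤ 1 / 3)
    (hε2 : 2 * θ.ν.εreg ≤ 2 * deltaSU (Fin 2) / ((((F.P p.K).d + 4) * (F.P p.K).L : ℕ) : ℝ) ^ 2)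
    (hM : 1 ≤ θ.ν.M₁) (hM₂ : 1 ≤ θ.ν.M₂) (h3 : 3 * side (F.P p.K).L θ.ν.M₁ 1 ≤ sideχ F θ.ν p (gOfRecord₁₃ F 2 θ p) 0)
    (hε₁ : 0 < epsOfRecord θ.ν (gOfRecord₁₃ F 2 θ p) 1 * (F.P p.K).eta 1 ^ 2)
    (hc : θ.s2.cR * epsOfRecord θ.ν (gOfRecord₁₃ F 2 θ p) 0 ≤ θ.ν.εreg * (F.P p.K).eta 0 ^ 2)
    (hαε : θ.s2.cR * epsOfRecord θ.ν (gOfRecord₁₃ F 2 θ p) 0 ≤ θ.ν.εreg * (F.P p.K).eta 1 ^ 2)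
    (hδ : epsOfRecord θ.ν (gOfRecord₁₃ F 2 θ p) 1 * (F.P p.K).eta 1 ^ 2 + 4 * (2 * deltaOfRecord θ.ν (gOfRecord₁₃ F 2 θ p) 0 θ.A₁) < 2) :
    ¬ (∀ k, k < p.K → SLaw₁₃ F 2 θ p k → TLaw₁₃ F 2 θ p k) := fun h =>
  not_tLaw₁₃_zero_su2_of_hasResidualsOfRecord_of_small_εreg θ p hres hK hMτ hε hε3 hε2 hM hM₂ h3 hε₁ hc hαε hδ (h 0 hK (sLaw₁₃_zero F 2 θ p))

end Negative

end Summit.QuantumFields.YangMills.Theorems.BalabanUVNodesN11SmallRegFirstStepFails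

end
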